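import Mathlib
import Summits.Ventures.PercRepro2.MixChordRoot

/-!
# The coincidence classes of root edges: `Gc` vanishes at the open end, (MIX-CHORD) is the
half-chord (blind cell PercRepro2, night-1 g19; proofs/NIGHT1-G19.md §3′)

When `o` is surely joined to `a₁` (on the support of the weight vector) the covariance form
vanishes: `Gc = Z·D·(E_Q[σ_b] + gap) = 0` (**`Gc_eq_zero_of_sure_conn_o`**); likewise when `b` is
surely joined to `a₁`: `Gc = Z·DEF − Z·DEF = 0` (**`Gc_eq_zero_of_sure_conn_b`**); the root swap
gives the `a₂` versions.  A root edge `e = {x, y}` with `x` in the weight-`1` cluster of a root and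
`o` (or `b`) in the weight-`1` cluster of `y` is such an edge once pinned open
(`conn_root_of_update_one`), so `Gc (p[e ↦ 1]) = 0` and (MIX-CHORD) along `e` reads

**(HALF-CHORD)** `(1 − p_e) · shrink p e · Gc (p[e ↦ 0]) ≤ Gc p`, i.e. `Gloc p ≥ (1 − p_e) · Gloc (p[e ↦ 0])`

(`HalfChord`, `mixChord_of_halfChord_of_coincidence`): «`G` decays at most linearly to `0` along
the edge» — the form of g18's root-edge chord theorem for `{a₃, a₁}`, census-true along the root
edges to `o` and to `b` (g18: 350 / 350 each; this seat 619 / 619, 624 / 624), open.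

Own code; standard axioms.
-/

namespace Summit.Ventures.PercRepro2

open UnionCluster CovForm

namespace Mix

open scoped Classical

section Vanish

variable {V : Type*} {E : Type*} [Fintype E] [DecidableEq E] [DecidableEq V] {R : Type*}
  [Field R] [LinearOrder R] [IsStrictOrderedRing R]

variable (p : E → R) (ends : E → Sym2 V) {a₁ a₂ : V} {m : V}

omit [DecidableEq V] [LinearOrder R] [IsStrictOrderedRing R] in
/-- If `a₁ ↔ m` on the support, the event `{a₁ ↔ m}` may be dropped from any intersection. -/
lemma prob_inter_conn_eq (h : ∀ ω, weight p ω ≠ 0 → Conn ends ω a₁ m) (A B : Set (Config E)) :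
    prob p (A ∩ (connEvent ends a₁ m ∩ B)) = prob p (A ∩ B) := by
  unfold prob
  refine Finset.sum_congr rfl fun ω _ => ?_
  by_cases hω : weight p ω = 0
  · simp [Set.indicator_apply, hω]
  · have hc : ω ∈ connEvent ends a₁ m := h ω hω
    by_cases hA : ω ∈ A ∩ B
    · rw [Set.indicator_of_mem hA,
        Set.indicator_of_mem (show ω ∈ A ∩ (connEvent ends a₁ m ∩ B) from ⟨hA.1, hc, hA.2⟩)]
    · rw [Set.indicator_of_notMem hA, Set.indicator_of_notMem (fun h' => hA ⟨h'.1, h'.2.2⟩)]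

omit [DecidableEq V] [LinearOrder R] [IsStrictOrderedRing R] in
/-- The same with `{a₁ ↔ m}` as the last factor. -/
lemma prob_inter_conn_eq' (h : ∀ ω, weight p ω ≠ 0 → Conn ends ω a₁ m) (A : Set (Config E)) :
    prob p (A ∩ connEvent ends a₁ m) = prob p A := by
  have := prob_inter_conn_eq p ends h A Set.univ
  simpa only [Set.inter_univ] using this

omit [DecidableEq V] [LinearOrder R] [IsStrictOrderedRing R] in
/-- The same with `{a₁ ↔ m}` as the inner last factor. -/
lemma prob_inter_inter_conn_eq (h : ∀ ω, weight p ω ≠ 0 → Conn ends ω a₁ m)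
    (A C : Set (Config E)) :
    prob p (A ∩ (C ∩ connEvent ends a₁ m)) = prob p (A ∩ C) := by
  rw [Set.inter_comm C, prob_inter_conn_eq p ends h]

omit [DecidableEq V] [LinearOrder R] [IsStrictOrderedRing R] in
/-- If `a₁ ↔ m` on the support, `{a₂ ↔ m}` is null inside every sub-event of `Q`. -/
lemma prob_inter_conn₂_eq_zero (h : ∀ ω, weight p ω ≠ 0 → Conn ends ω a₁ m)
    (A B : Set (Config E)) (hA : A ⊆ avoidAll ends a₂ {a₁}) :
    prob p (A ∩ (connEvent ends a₂ m ∩ B)) = 0 := by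
  unfold prob
  refine Finset.sum_eq_zero fun ω _ => ?_
  by_cases hω : weight p ω = 0
  · simp [Set.indicator_apply, hω]
  · rw [Set.indicator_of_notMem]
    rintro ⟨hQ, h2, _⟩
    exact hA hQ a₁ (Finset.mem_singleton_self a₁) (conn_trans h2 (conn_symm (h ω hω)))

omit [DecidableEq V] [LinearOrder R] [IsStrictOrderedRing R] in
/-- The same with `{a₂ ↔ m}` as the last factor. -/
lemma prob_inter_conn₂_eq_zero' (h : ∀ ω, weight p ω ≠ 0 → Conn ends ω a₁ m)
    (A : Set (Config E)) (hA : A ⊆ avoidAll ends a₂ {a₁}) :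
    prob p (A ∩ connEvent ends a₂ m) = 0 := by
  have := prob_inter_conn₂_eq_zero p ends h A Set.univ hA
  simpa only [Set.inter_univ] using this

omit [DecidableEq V] [LinearOrder R] [IsStrictOrderedRing R] in
/-- The same with `{a₂ ↔ m}` as the inner last factor. -/
lemma prob_inter_inter_conn₂_eq_zero (h : ∀ ω, weight p ω ≠ 0 → Conn ends ω a₁ m)
    (A C : Set (Config E)) (hA : A ⊆ avoidAll ends a₂ {a₁}) :
    prob p (A ∩ (C ∩ connEvent ends a₂ m)) = 0 := by
  rw [Set.inter_comm C, prob_inter_conn₂_eq_zero p ends h _ _ hA]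

omit [DecidableEq V] [LinearOrder R] [IsStrictOrderedRing R] in
/-- `{a₂ ↔ m}` is null inside `Q` when `a₁ ↔ m` on the support (the `gap` form). -/
lemma prob_Q_conn₂_eq_zero (h : ∀ ω, weight p ω ≠ 0 → Conn ends ω a₁ m) :
    prob p (avoidAll ends a₂ {a₁} ∩ connEvent ends a₂ m) = 0 :=
  prob_inter_conn₂_eq_zero' p ends h _ le_rfl

omit [DecidableEq V] in
/-- **`Gc = 0` when `o` is surely joined to `a₁`**: `Gc = Z·D·(E_Q[σ_b] + gap) = 0`. -/
theorem Gc_eq_zero_of_sure_conn_o (o a₃ b : V)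
    (h : ∀ ω, weight p ω ≠ 0 → Conn ends ω a₁ o) : Gc p ends o a₁ a₂ a₃ b = 0 := by
  have hPDs := Chord.PDEvent_subset_avoidAll ends a₁ a₂ a₃
  have hTs := TEvent_subset_Q ends a₁ a₂ a₃
  have hT's := TEvent_swap_subset_Q ends a₁ a₂ a₃
  have hQs : avoidAll ends a₂ {a₁} ⊆ avoidAll ends a₂ {a₁} := le_rfl
  unfold Gc DEF EQbo EQb3 EQb3o EQo EQ3 EQ3o PDb PDbo Do
  rw [gap_eq_Q]
  simp only [prob_inter_conn_eq p ends h, prob_inter_conn_eq' p ends h,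
    prob_inter_conn₂_eq_zero p ends h _ _ hQs, prob_inter_conn₂_eq_zero p ends h _ _ hPDs,
    prob_inter_conn₂_eq_zero p ends h _ _ hTs, prob_inter_conn₂_eq_zero p ends h _ _ hT's,
    prob_inter_conn₂_eq_zero' p ends h _ hQs, prob_inter_conn₂_eq_zero' p ends h _ hPDs,
    prob_inter_conn₂_eq_zero' p ends h _ hTs, prob_inter_conn₂_eq_zero' p ends h _ hT's]
  ring

omit [DecidableEq V] in
/-- **`Gc = 0` when `b` is surely joined to `a₁`**: `Gc = Z·DEF − Z·DEF = 0`. -/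
theorem Gc_eq_zero_of_sure_conn_b (o a₃ b : V)
    (h : ∀ ω, weight p ω ≠ 0 → Conn ends ω a₁ b) : Gc p ends o a₁ a₂ a₃ b = 0 := by
  have hPDs := Chord.PDEvent_subset_avoidAll ends a₁ a₂ a₃
  have hTs := TEvent_subset_Q ends a₁ a₂ a₃
  have hT's := TEvent_swap_subset_Q ends a₁ a₂ a₃
  have hQs : avoidAll ends a₂ {a₁} ⊆ avoidAll ends a₂ {a₁} := le_rfl
  unfold Gc DEF EQbo EQb3 EQb3o EQo EQ3 EQ3o PDb PDbo Do
  rw [gap_eq_Q]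
  simp only [prob_inter_conn_eq' p ends h, prob_inter_inter_conn_eq p ends h,
    prob_inter_conn₂_eq_zero' p ends h _ hQs, prob_inter_conn₂_eq_zero' p ends h _ hPDs,
    prob_inter_conn₂_eq_zero' p ends h _ hTs, prob_inter_conn₂_eq_zero' p ends h _ hT's,
    prob_inter_inter_conn₂_eq_zero p ends h _ _ hQs, prob_inter_inter_conn₂_eq_zero p ends h _ _ hPDs,
    prob_inter_inter_conn₂_eq_zero p ends h _ _ hTs, prob_inter_inter_conn₂_eq_zero p ends h _ _ hT's]
  ring

end Vanish

section Coincidence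

variable {V : Type*} {E : Type*} [Fintype E] [DecidableEq E] [DecidableEq V] {R : Type*}
  [Field R] [LinearOrder R] [IsStrictOrderedRing R]

variable (p : E → R) (ends : E → Sym2 V) {a₁ : V} {e : E} {x y m : V}

omit [DecidableEq V] in
/-- A root edge pinned open joins its root to the far end's weight-`1` cluster. -/
lemma conn_root_of_update_one (hx : x ∈ cluster ends (Chord.oneConfig p) a₁)
    (hm : m ∈ cluster ends (Chord.oneConfig p) y) (he : ends e = s(x, y)) :
    ∀ ω, weight (Function.update p e 1) ω ≠ 0 → Conn ends ω a₁ m := by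
  intro ω hω
  have hωe : ω e = true := eq_true_of_weight_update_one_ne_zero hω
  have hle : Chord.oneConfig p ≤ ω :=
    (oneConfig_le_update_one p e).trans (oneConfig_le_of_weight_ne_zero hω)
  have h1x : Conn ends ω a₁ x := conn_mono hle (mem_cluster.1 hx)
  have hym : Conn ends ω y m := conn_mono hle (mem_cluster.1 hm)
  have hxy : Conn ends ω x y := conn_of_openAdj ⟨e, hωe, he⟩
  exact conn_trans h1x (conn_trans hxy hym)

/-- **(HALF-CHORD)** along `e`: `(1 − p_e) · shrink p e · Gc (p[e ↦ 0]) ≤ Gc p`. -/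
def HalfChord (o a₁ a₂ a₃ b : V) (e : E) : Prop :=
  (1 - p e) * (shrink p ends a₁ a₂ a₃ e * Gc (Function.update p e 0) ends o a₁ a₂ a₃ b) ≤
    Gc p ends o a₁ a₂ a₃ b

omit [DecidableEq V] in
/-- Along a root edge from the cluster of `a₁` to the cluster of `o` (or of `b`), (MIX-CHORD) is
the half-chord: the open end has `Gc = 0`. -/
theorem mixChord_of_halfChord_of_coincidence (o a₂ a₃ b : V)
    (hx : x ∈ cluster ends (Chord.oneConfig p) a₁) (he : ends e = s(x, y))
    (hm : o ∈ cluster ends (Chord.oneConfig p) y ∨ b ∈ cluster ends (Chord.oneConfig p) y)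
    (hh : HalfChord p ends o a₁ a₂ a₃ b e) :
    p e * Gc (Function.update p e 1) ends o a₁ a₂ a₃ b +
      (1 - p e) * (shrink p ends a₁ a₂ a₃ e * Gc (Function.update p e 0) ends o a₁ a₂ a₃ b) ≤
        Gc p ends o a₁ a₂ a₃ b := by
  have hG1 : Gc (Function.update p e 1) ends o a₁ a₂ a₃ b = 0 := by
    rcases hm with hm | hm
    · exact Gc_eq_zero_of_sure_conn_o _ ends o a₃ b (conn_root_of_update_one p ends hx hm he)
    · exact Gc_eq_zero_of_sure_conn_b _ ends o a₃ b (conn_root_of_update_one p ends hx hm he)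
  rw [hG1, mul_zero, zero_add]
  exact hh

omit [DecidableEq V] in
/-- The `a₂`-side version: a root edge from the cluster of `a₂` to the cluster of `o` or of `b`. -/
theorem mixChord_of_halfChord_of_coincidence₂ (o a₂ a₃ b : V)
    (hx : x ∈ cluster ends (Chord.oneConfig p) a₂) (he : ends e = s(x, y))
    (hm : o ∈ cluster ends (Chord.oneConfig p) y ∨ b ∈ cluster ends (Chord.oneConfig p) y)
    (hh : HalfChord p ends o a₁ a₂ a₃ b e) :
    p e * Gc (Function.update p e 1) ends o a₁ a₂ a₃ b +
      (1 - p e) * (shrink p ends a₁ a₂ a₃ e * Gc (Function.update p e 0) ends o a₁ a₂ a₃ b) ≤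
        Gc p ends o a₁ a₂ a₃ b := by
  have hG1 : Gc (Function.update p e 1) ends o a₂ a₁ a₃ b = 0 := by
    rcases hm with hm | hm
    · exact Gc_eq_zero_of_sure_conn_o _ ends o a₃ b (conn_root_of_update_one p ends hx hm he)
    · exact Gc_eq_zero_of_sure_conn_b _ ends o a₃ b (conn_root_of_update_one p ends hx hm he)
  rw [CovForm.Gc_swap] at hG1
  rw [hG1, mul_zero, zero_add]
  exact hh

end Coincidence

end Mix

end Summit.Ventures.PercRepro2
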